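import Mathlib
import Summits.NavierStokesRegularity.NavierStokesRegularity.Theorems.EulerZoomLiouvillePowerGaugeEulerLiouvilleSelfSimilarNodeCertificates
import Summits.NavierStokesRegularity.NavierStokesRegularity.Theorems.EulerZoomLiouvillePowerGaugeEulerLiouvilleSelfSimilarPlanarConeCertificate
import Literature.Analysis.FluidPDE.SelfSimilarEulerOutgoing
import Literature.Analysis.FluidPDE.CylinderInversion
import Literature.Analysis.Convexity.AnisotropicPerimeterPolytopePrism
import HarnessLib.Audit

/-!
# Rung C1 of the crux `EulerZoomLiouville.PowerGaugeEulerLiouville`: the certificate at a VORTICAL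
# stagnation point, and the UNCONDITIONAL NODAL-FINITENESS EXCLUSION

Route №10 `EulerZoomLiouville` (NavierStokesRegularity), crux E = stmt-NavierStokesRegularity-19832,
tenure rung C1 (exactly self-similar members), registered residue `stub_selfSimilarExtremal`.
Seventh (last) file of the NODAL-FINITENESS chain (lineage ns-typeII-p2, gen 6).

At a VORTICAL node `z` (`Ω(z) = curl U(z) ≠ 0`) of a `C²` self-similar Euler profile, the vorticity
equation at `z` gives `DU(z)Ω(z) = Ω(z)` (tree `fderiv_apply_curl_eq_of_mem_nodalSet`), and since the
antisymmetric part of `DU(z)` is `½ Ω(z) × ·`, the line `ℝξ`, `ξ = Ω(z)/|Ω(z)|`, and the plane `ξ^⊥`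
are BOTH invariant under `M = DV(z) = γI + DU(z)`: in an orthonormal frame `(ξ, w₁, w₂)`,
`M = (1+γ) ⊕ N` with a real `2 × 2` block `N` of trace `3γ − (1+γ) = 2γ − 1 < 0`.

* `inner_fderiv_comm_of_parallel_curl` — `⟪DU ξ, w⟫ = ⟪DU w, ξ⟫` for `ξ ∥ curl U(z)` (Majda–Bertozzi
  (1.24), tree `inner_fderiv_sub_inner_fderiv_eq_curl`).
* `certificate_of_curl_ne_zero` — a vortical node of an in-window profile carries a THIN certificate
  (frame via tree `exists_orthonormal_pair_perp`, trace via `div U = 0`, then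
  `coneCertificate_of_invariant_splitting`).
* `certificate_of_mem_nodalSet` — EVERY node of an in-window profile is certified (non-vortical:
  `certificate_of_curl_eq_zero`).
* `eq_zero_of_finite_nodalSet` — **MAIN THEOREM (unconditional): a `C²` self-similar Euler profile
  with `0 < γ < ½` and the far-field bounds (3.8) whose transport field `V = γ(y−c) + U` has only
  FINITELY MANY stagnation points is trivial, `U ≡ 0`.**  `selfSimilarNodalSet_infinite_of_ne_zero`:
  a nontrivial classical in-window profile with CIV's far field has INFINITELY MANY stagnation points;
  `eq_zero_of_finite_nodalSet_of_exponent`: exponent form `γ = 1/(2+ρ)`, `ρ > 0`.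
  (CIV 2026 Thm 3.10: finitely many nodes + the local outgoing inequality + analyticity of `Ω` at the
  nodes ⇒ trivial.  Here: finitely many nodes ⇒ trivial.)

WHAT THIS IS NOT: not NS, not E, not rung C1 — classical (`C²`) profiles with the far field (3.8);
the weak-class residue of `stub_selfSimilarExtremal` and profiles with infinite nodal sets are untouched.

## References

* P. Constantin, M. Ignatova, V. Vicol, arXiv:2602.17570 (2026), §3.5 Def 3.7, Thms 3.8–3.10.
  [ConstantinIgnatovaVicol2026Putative]
* A. J. Majda, A. L. Bertozzi, CUP 2002, §1.4 (1.24). [MajdaBertozziCUP2002]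
-/

noncomputable section

-- flat `Theorems/<Route><Decl>…` files of one crux share the namespace of the crux (tree convention)
set_option linter.dupNamespace false

open Set Filter Topology Metric Function InnerProductSpace
open scoped RealInnerProductSpace NNReal

namespace Summit.NavierStokesRegularity.NavierStokesRegularity.Theorems.PowerGaugeEulerLiouville.NodalFiniteness

open Literature.Analysis Literature.Analysis.FluidPDE Literature.Analysis.ODE

/-! ### Vortical stagnation points are certified -/

variable {γ C : ℝ} {c : EuclideanSpace ℝ (Fin 3)}
  {U : EuclideanSpace ℝ (Fin 3) → EuclideanSpace ℝ (Fin 3)} {P : EuclideanSpace ℝ (Fin 3) → ℝ}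

/-- If `ξ` is parallel to `curl U(z)` then `DU(z)` is symmetric against `ξ`:
`⟪DU ξ, w⟫ = ⟪DU w, ξ⟫` (the antisymmetric part of `DU` is `½ Ω × ·`, Majda–Bertozzi (1.24); tree
`inner_fderiv_sub_inner_fderiv_eq_curl`). [cite: MajdaBertozziCUP2002, §1.4 eq. (1.24)] -/
theorem inner_fderiv_comm_of_parallel_curl {z : EuclideanSpace ℝ (Fin 3)} {m : ℝ}
    (w : EuclideanSpace ℝ (Fin 3)) :
    ⟪fderiv ℝ U z (m • curl U z), w⟫ = ⟪fderiv ℝ U z w, m • curl U z⟫ := by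
  have e := inner_fderiv_sub_inner_fderiv_eq_curl (v := U) (p := z) (m • curl U z) w
  have hz : curl U z 0 * ((m • curl U z) 1 * w 2 - (m • curl U z) 2 * w 1) +
      curl U z 1 * ((m • curl U z) 2 * w 0 - (m • curl U z) 0 * w 2) +
      curl U z 2 * ((m • curl U z) 0 * w 1 - (m • curl U z) 1 * w 0) = 0 := by
    simp only [PiLp.smul_apply, smul_eq_mul]; ring
  rw [hz] at e
  linarith

/-- **A vortical node of an in-window profile is certified (THIN).**  Let `z` be a stagnation point
with `Ω(z) = curl U(z) ≠ 0` and `γ < ½`.  With `ξ = Ω(z)/|Ω(z)|`: `DV(z)ξ = (1+γ)ξ`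
(`DU(z)Ω(z) = Ω(z)`), the plane `ξ^⊥` is `DV(z)`-invariant (`inner_fderiv_comm_of_parallel_curl`), and
the `2 × 2` block has trace `3γ − (1+γ) = 2γ − 1 < 0` (`div U = 0`); so
`coneCertificate_of_invariant_splitting` applies in an orthonormal frame `(ξ, w₁, w₂)`.
[cite: ConstantinIgnatovaVicol2026Putative, §3.5 proof of Thm 3.8 ("`𝕊_{y_*}` has `1` as an eigenvalue")] -/
theorem certificate_of_curl_ne_zero (h : IsSelfSimilarEulerProfile γ c U P) (hγ : 0 < γ)
    (hγ2 : γ < 1 / 2) {z : EuclideanSpace ℝ (Fin 3)} (hz : z ∈ selfSimilarNodalSet γ c U)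
    (hΩz : curl U z ≠ 0) :
    ∃ (Q : EuclideanSpace ℝ (Fin 3) →L[ℝ] EuclideanSpace ℝ (Fin 3) →L[ℝ] ℝ) (η θ : ℝ)
      (e : EuclideanSpace ℝ (Fin 3)), 0 < η ∧ θ ≤ 0 ∧ 0 < Q e e ∧
      ∀ v, Q (fderiv ℝ (selfSimilarTransport γ c U) z v) v +
        Q v (fderiv ℝ (selfSimilarTransport γ c U) z v) ≤ 2 * θ * Q v v - η * ‖v‖ ^ 2 := by
  have hUd := h.differentiable_velocity
  set M := fderiv ℝ (selfSimilarTransport γ c U) z with hMdef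
  have hDV : M = γ • ContinuousLinearMap.id ℝ _ + fderiv ℝ U z :=
    (hasFDerivAt_selfSimilarTransport hUd z).fderiv
  have hMv : ∀ v, M v = γ • v + fderiv ℝ U z v := fun v => by
    rw [hDV]; rfl
  -- the unit vorticity direction
  set mΩ : ℝ := ‖curl U z‖ with hmΩ
  have hmpos : 0 < mΩ := norm_pos_iff.2 hΩz
  set ξ : EuclideanSpace ℝ (Fin 3) := mΩ⁻¹ • curl U z with hξ
  have hξ1 : ‖ξ‖ = 1 := by
    rw [hξ, norm_smul, norm_inv, norm_norm, inv_mul_cancel₀ hmpos.ne']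
  -- `DU ξ = ξ`, hence `M ξ = (1+γ) ξ`
  have hDUξ : fderiv ℝ U z ξ = ξ := by
    rw [hξ, map_smul, h.isSelfSimilarEulerVorticityProfile.fderiv_apply_curl_eq_of_mem_nodalSet hz]
  have hMξ : M ξ = (1 + γ) • ξ := by rw [hMv, hDUξ, add_smul, one_smul, add_comm]
  -- an orthonormal frame `(ξ, w₁, w₂)`
  obtain ⟨w₁, w₂, hw₁, hw₂, hw₁₂, hξw₁, hξw₂⟩ := Convexity.exists_orthonormal_pair_perp ξ
  set f : Fin 3 → EuclideanSpace ℝ (Fin 3) := ![ξ, w₁, w₂] with hf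
  have hw₁ξ : ⟪w₁, ξ⟫ = 0 := by rw [real_inner_comm]; exact hξw₁
  have hw₂ξ : ⟪w₂, ξ⟫ = 0 := by rw [real_inner_comm]; exact hξw₂
  have hw₂₁ : ⟪w₂, w₁⟫ = 0 := by rw [real_inner_comm]; exact hw₁₂
  have hfon : Orthonormal ℝ f := by
    rw [orthonormal_iff_ite]
    intro i j
    fin_cases i <;> fin_cases j <;>
      simp [hf, hξ1, hw₁, hw₂, hw₁₂, hξw₁, hξw₂, hw₁ξ, hw₂ξ, hw₂₁]
  have hcard : Fintype.card (Fin 3) = Module.finrank ℝ (EuclideanSpace ℝ (Fin 3)) := by simp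
  set b : OrthonormalBasis (Fin 3) ℝ (EuclideanSpace ℝ (Fin 3)) :=
    (basisOfOrthonormalOfCardEqFinrank hfon hcard).toOrthonormalBasis
      (by rw [coe_basisOfOrthonormalOfCardEqFinrank]; exact hfon) with hb
  have hb_apply : ∀ i, b i = f i := fun i => by
    rw [hb, Module.Basis.coe_toOrthonormalBasis, coe_basisOfOrthonormalOfCardEqFinrank]
  have hb0 : b 0 = ξ := by rw [hb_apply]; rfl
  have hb1 : b 1 = w₁ := by rw [hb_apply]; rfl
  have hb2 : b 2 = w₂ := by rw [hb_apply]; rfl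
  -- invariance of `ξ^⊥`: `⟪ξ, M w⟫ = 0` for `w ⊥ ξ`
  have hinv : ∀ w, ⟪ξ, w⟫ = 0 → ⟪ξ, M w⟫ = 0 := by
    intro w hw
    rw [hMv, inner_add_right, inner_smul_right, hw, mul_zero, zero_add]
    have e1 : ⟪fderiv ℝ U z ξ, w⟫ = ⟪fderiv ℝ U z w, ξ⟫ := inner_fderiv_comm_of_parallel_curl w
    rw [hDUξ] at e1
    rw [real_inner_comm, ← e1, hw]
  -- expansions of `M w₁`, `M w₂` in the frame
  have hexpand : ∀ v : EuclideanSpace ℝ (Fin 3), v = ⟪ξ, v⟫ • ξ + ⟪w₁, v⟫ • w₁ + ⟪w₂, v⟫ • w₂ := by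
    intro v
    conv_lhs => rw [← b.sum_repr' v]
    rw [Fin.sum_univ_three, hb0, hb1, hb2]
  have hMw₁ : M w₁ = ⟪w₁, M w₁⟫ • w₁ + ⟪w₂, M w₁⟫ • w₂ := by
    have e := hexpand (M w₁)
    rw [hinv w₁ hξw₁, zero_smul, zero_add] at e
    exact e
  have hMw₂ : M w₂ = ⟪w₁, M w₂⟫ • w₁ + ⟪w₂, M w₂⟫ • w₂ := by
    have e := hexpand (M w₂)
    rw [hinv w₂ hξw₂, zero_smul, zero_add] at e
    exact e
  -- trace: `tr M = 3γ`, and `tr M = ⟪ξ,Mξ⟫ + ⟪w₁,Mw₁⟫ + ⟪w₂,Mw₂⟫`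
  have htrM : LinearMap.trace ℝ _ (M : EuclideanSpace ℝ (Fin 3) →ₗ[ℝ] EuclideanSpace ℝ (Fin 3)) =
      3 * γ := by
    have hdiv : LinearMap.trace ℝ _ (fderiv ℝ U z :
        EuclideanSpace ℝ (Fin 3) →ₗ[ℝ] EuclideanSpace ℝ (Fin 3)) = 0 := h.divFree z
    rw [hDV, ContinuousLinearMap.toLinearMap_add, ContinuousLinearMap.toLinearMap_smul, map_add,
      map_smul, hdiv, ContinuousLinearMap.coe_id, LinearMap.trace_id, finrank_euclideanSpace,
      Fintype.card_fin]
    norm_num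
    ring
  have htr' : ⟪w₁, M w₁⟫ + ⟪w₂, M w₂⟫ = 2 * γ - 1 := by
    have e := LinearMap.trace_eq_sum_inner (M : EuclideanSpace ℝ (Fin 3) →ₗ[ℝ] EuclideanSpace ℝ (Fin 3)) b
    rw [htrM, Fin.sum_univ_three, hb0, hb1, hb2] at e
    simp only [ContinuousLinearMap.coe_coe] at e
    rw [hMξ, inner_smul_right, real_inner_self_eq_norm_sq, hξ1] at e
    linarith
  have htr : ⟪w₁, M w₁⟫ + ⟪w₂, M w₂⟫ < 0 := by rw [htr']; linarith
  -- apply the linear algebra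
  have h0' : M (b 0) = (1 + γ) • b 0 := by rw [hb0]; exact hMξ
  have h1' : M (b 1) = ⟪w₁, M w₁⟫ • b 1 + ⟪w₂, M w₁⟫ • b 2 := by rw [hb1, hb2]; exact hMw₁
  have h2' : M (b 2) = ⟪w₁, M w₂⟫ • b 1 + ⟪w₂, M w₂⟫ • b 2 := by rw [hb1, hb2]; exact hMw₂
  exact coneCertificate_of_invariant_splitting b M (by linarith) h0' h1' h2' htr

/-- **Every stagnation point of an in-window profile is certified** (non-vortical:
`certificate_of_curl_eq_zero`; vortical: `certificate_of_curl_ne_zero`).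
[cite: ConstantinIgnatovaVicol2026Putative, §3.5 Thms 3.8–3.10] -/
theorem certificate_of_mem_nodalSet (h : IsSelfSimilarEulerProfile γ c U P) (hγ : 0 < γ)
    (hγ2 : γ < 1 / 2) {z : EuclideanSpace ℝ (Fin 3)} (hz : z ∈ selfSimilarNodalSet γ c U) :
    (∃ (B : EuclideanSpace ℝ (Fin 3) →L[ℝ] EuclideanSpace ℝ (Fin 3) →L[ℝ] ℝ) (cB β' : ℝ),
        0 < cB ∧ β' < 1 + γ ∧ (∀ v, cB * ‖v‖ ^ 2 ≤ B v v) ∧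
        ∀ v, B (fderiv ℝ (selfSimilarTransport γ c U) z v) v +
          B v (fderiv ℝ (selfSimilarTransport γ c U) z v) ≤ 2 * β' * B v v) ∨
      (∃ (Q : EuclideanSpace ℝ (Fin 3) →L[ℝ] EuclideanSpace ℝ (Fin 3) →L[ℝ] ℝ) (η θ : ℝ)
        (e : EuclideanSpace ℝ (Fin 3)), 0 < η ∧ θ ≤ 0 ∧ 0 < Q e e ∧
        ∀ v, Q (fderiv ℝ (selfSimilarTransport γ c U) z v) v +
          Q v (fderiv ℝ (selfSimilarTransport γ c U) z v) ≤ 2 * θ * Q v v - η * ‖v‖ ^ 2) := by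
  by_cases hΩz : curl U z = 0
  · exact certificate_of_curl_eq_zero h hγ2 hΩz
  · exact Or.inr (certificate_of_curl_ne_zero h hγ hγ2 hz hΩz)

/-! ### The unconditional theorem -/

/-- **NODAL-FINITENESS EXCLUSION (unconditional).**  Let `0 < γ < ½` and let `(U, P)` be a `C²`
self-similar Euler profile (CIV (3.3)) with the far-field bounds (3.8).  If the transport field
`V = γ(y−c) + U` has only FINITELY MANY stagnation points, then `U ≡ 0`.  Equivalently: a nontrivial
classical in-window profile with CIV's far field has INFINITELY MANY stagnation points.  (Every node is
certified by `certificate_of_mem_nodalSet`; conclude with `eq_zero_of_finite_nodalSet_of_certificates`: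
backward trajectories converge to nodes, KILL nodes receive no vorticity, THIN nodes receive only a
meagre set, Baire.)  CIV Thm 3.10 assumes in addition the local outgoing inequality at every node and
analyticity of `Ω` there.
[cite: ConstantinIgnatovaVicol2026Putative, §3.5 Thm 3.10 (finite nodal set; outgoing inequality and analyticity removed)] -/
theorem eq_zero_of_finite_nodalSet (h : IsSelfSimilarEulerProfile γ c U P) (hγ : 0 < γ)
    (hγ2 : γ < 1 / 2) (hfar : HasSelfSimilarFarFieldWith γ c C U)
    (hfin : (selfSimilarNodalSet γ c U).Finite) : U = 0 :=
  eq_zero_of_finite_nodalSet_of_certificates h hγ hγ2 hfar hfin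
    fun _ hz => certificate_of_mem_nodalSet h hγ hγ2 hz

/-- **Contrapositive: a nontrivial in-window profile has an infinite nodal set.**
[cite: ConstantinIgnatovaVicol2026Putative, §3.5 Thm 3.10 (finite nodal set; outgoing inequality and analyticity removed)] -/
theorem selfSimilarNodalSet_infinite_of_ne_zero (h : IsSelfSimilarEulerProfile γ c U P) (hγ : 0 < γ)
    (hγ2 : γ < 1 / 2) (hfar : HasSelfSimilarFarFieldWith γ c C U) (hU : U ≠ 0) :
    (selfSimilarNodalSet γ c U).Infinite :=
  fun hfin => hU (eq_zero_of_finite_nodalSet h hγ hγ2 hfar hfin)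

/-- **Exponent form** (route EulerZoomLiouville: `γ = 1/(2+ρ)`, window `ρ > 0`).
[cite: ConstantinIgnatovaVicol2026Putative, §3.5 Thm 3.10 (finite nodal set; outgoing inequality and analyticity removed)] -/
theorem eq_zero_of_finite_nodalSet_of_exponent {ρ : ℝ} (hρ : 0 < ρ)
    (h : IsSelfSimilarEulerProfile (1 / (2 + ρ)) c U P)
    (hfar : HasSelfSimilarFarFieldWith (1 / (2 + ρ)) c C U)
    (hfin : (selfSimilarNodalSet (1 / (2 + ρ)) c U).Finite) : U = 0 := by
  have hγ : 0 < 1 / (2 + ρ) := by positivity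
  have hγ2 : 1 / (2 + ρ) < 1 / 2 := by
    rw [div_lt_div_iff₀ (by positivity) (by positivity)]; linarith
  exact eq_zero_of_finite_nodalSet h hγ hγ2 hfar hfin

end Summit.NavierStokesRegularity.NavierStokesRegularity.Theorems.PowerGaugeEulerLiouville.NodalFiniteness
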